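import Summits.KontsevichZagierPeriods.KontsevichZagierPeriods.Theorems.AperySectorThreeTwo.Negative.LoadBearing
import Literature.NumberTheory.Transcendental.BoxCoordinatePowerMap

/-!
# `AperySectorThreeTwo` (stmt-KontsevichZagierPeriods-3873): negative side III — rule (1) alone
# cannot prove the crux (load-bearing MOVES)

Companion of `Negative/Kit.lean`, `Negative/LoadBearing.lean` (cdisprove unit of the crux
`AperySectorThreeTwo`, route `HurwitzMicroSectors`). Localised evaluation
`evalOn A [r] = ∫_{σ ∩ A n} f` against a family of measurable test sets is an additive invariant of
the two ADDITIVITY moves (same computation as the soundness of rule (1)) but not of rules (2), (3):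
`addOnlyRelations_le_ker_evalOn : closure (domainAddRel ∪ integrandAddRel) ≤ ker (evalOn A)`.
On the corner `(0,½)³` it separates

* the polynomial pair `[box, 1]`, `[box, 8t]` of `LoadBearing.lean` (masses `1/8 ≠ 1/64`):
  `aperySectorThreeTwo_needs_rule_two_or_three`;
* the POLAR pair `[box, 1/(1−t²)]`, `[box, 7t/(1−t²)]` (equal values `h₀ = 7h₁ = 7ζ(3)/8`; corner
  mass of `(1 − 7t)/(1 − t²)` is `≥ 1/64`): `aperySectorThreeTwo_polar_needs_rule_two_or_three` —
  the distribution relation `H₀ ∼ 7H₁` is NOT an additivity relation.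

Hence every chain between equal-valued members — a fortiori any proof of the crux — contains a
change of variables (rule 2) or a Newton–Leibniz move (rule 3); the route's ONE dilation
`xᵢ ↦ xᵢ²` is unavoidable modulo rule (3). §6 TIGHTNESS: it also suffices —
`dilation_mem_changeOfVariablesRel` (the dilation `xᵢ ↦ xᵢᵐ` on the box is ONE rule-(2) instance,
analysis from `BoxCoordinatePowerMap.lean`), `poly_pair_equivalent : [box,1] ~ [box,8t]` (one
move), `polar_equivalent : [box, 1/(1−t²)] ~ [box, 7t/(1−t²)]` (one dilation + two integrand
additivities: the distribution relation `H₀ ∼ 7H₁` as an honest KZ-equivalence).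

Sources: M. Kontsevich, D. Zagier, *Periods* (2001), §1.2.
-/

noncomputable section

open MeasureTheory Set MvPolynomial intervalIntegral
open Literature.NumberTheory.Transcendental Literature.ModelTheory.ExponentialFields

namespace Summit.KontsevichZagierPeriods.Theorems.AperySectorThreeTwo.Negative

open Summit.KontsevichZagierPeriods.KontsevichZagierPeriods.Theses.HurwitzMicroSectors
  (AperySectorThreeTwo)

/-! ## §4 Rule (1) alone cannot prove the crux (load-bearing MOVES)

Localised evaluation `evalOn A [r] = ∫_{σ ∩ A n} f` against a family of measurable test sets is an
additive invariant of the two ADDITIVITY moves (same computation as the soundness of rule (1)), but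
not of rules (2), (3). It separates the equal-valued pair `[box, 1]`, `[box, 8t]` of `LoadBearing.lean` (test set:
the sub-box `(0,½)³`, masses `1/8 ≠ 1/64`). Hence every chain of moves between them — and a
fortiori any proof of `AperySectorThreeTwo` — contains a change of variables or a Newton–Leibniz
move. (The route's chain uses exactly ONE change of variables, the dilation `xᵢ ↦ xᵢ²`.) -/

/-- Localised evaluation against a family of test sets `A n ⊆ ℝⁿ`. [folklore] -/
def evalOn (A : (n : ℕ) → Set (Fin n → ℝ)) : KZ.FormalRep →+ ℝ :=
  FreeAbelianGroup.lift fun s => ∫ x in s.2.domain ∩ A s.1, s.2.integrand x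

/-- Auxiliary: `evalOn_of`. [folklore] -/
@[simp] theorem evalOn_of (A : (n : ℕ) → Set (Fin n → ℝ)) {n : ℕ} (r : KZ.IntegralRep n) :
    evalOn A (KZ.of r) = ∫ x in r.domain ∩ A n, r.integrand x :=
  FreeAbelianGroup.lift_apply_of _ _

/-- The sub-calculus generated by the two additivity moves only. [folklore] -/
def addOnlyRelations : AddSubgroup KZ.FormalRep :=
  AddSubgroup.closure (KZ.domainAddRel ∪ KZ.integrandAddRel)

/-- The additivity-only sub-calculus is part of the KZ calculus. [folklore] -/
theorem addOnlyRelations_le_relations : addOnlyRelations ≤ KZ.relations := by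
  refine (AddSubgroup.closure_le _).mpr ?_
  rintro c (hc | hc)
  · exact KZ.domainAddRel_subset_relations hc
  · exact KZ.integrandAddRel_subset_relations hc

/-- Localised evaluation kills domain additivity. [folklore] -/
theorem evalOn_eq_zero_of_mem_domainAddRel {A : (n : ℕ) → Set (Fin n → ℝ)}
    (hA : ∀ n, MeasurableSet (A n)) {c : KZ.FormalRep} (hc : c ∈ KZ.domainAddRel) :
    evalOn A c = 0 := by
  obtain ⟨n, r, r₁, r₂, hdom, hnull, h₁, h₂, rfl⟩ := hc
  simp only [map_sub, evalOn_of]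
  rw [sub_sub, sub_eq_zero]
  have hm₁ : MeasurableSet (r₁.domain ∩ A n) :=
    (KZ.IntegralRep.measurableSet_domain_holds r₁).inter (hA n)
  have hm₂ : MeasurableSet (r₂.domain ∩ A n) :=
    (KZ.IntegralRep.measurableSet_domain_holds r₂).inter (hA n)
  have hae : AEDisjoint volume (r₁.domain ∩ A n) (r₂.domain ∩ A n) :=
    measure_mono_null (inter_subset_inter inter_subset_left inter_subset_left) hnull
  have hset : r.domain ∩ A n = (r₁.domain ∩ A n) ∪ (r₂.domain ∩ A n) := by
    rw [hdom, union_inter_distrib_right]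
  have hi₁ : IntegrableOn r.integrand (r₁.domain ∩ A n) :=
    r.integrableOn.mono_set (by rw [hdom]; exact inter_subset_left.trans subset_union_left)
  have hi₂ : IntegrableOn r.integrand (r₂.domain ∩ A n) :=
    r.integrableOn.mono_set (by rw [hdom]; exact inter_subset_left.trans subset_union_right)
  rw [hset, setIntegral_union₀ hae hm₂.nullMeasurableSet hi₁ hi₂,
    setIntegral_congr_fun hm₁ (h₁.mono inter_subset_left),
    setIntegral_congr_fun hm₂ (h₂.mono inter_subset_left)]

/-- Localised evaluation kills integrand additivity. [folklore] -/
theorem evalOn_eq_zero_of_mem_integrandAddRel {A : (n : ℕ) → Set (Fin n → ℝ)}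
    (hA : ∀ n, MeasurableSet (A n)) {c : KZ.FormalRep} (hc : c ∈ KZ.integrandAddRel) :
    evalOn A c = 0 := by
  obtain ⟨n, r, r₁, r₂, h₁, h₂, hadd, rfl⟩ := hc
  simp only [map_sub, evalOn_of]
  rw [sub_sub, sub_eq_zero, h₁, h₂]
  have hm : MeasurableSet (r.domain ∩ A n) :=
    (KZ.IntegralRep.measurableSet_domain_holds r).inter (hA n)
  rw [setIntegral_congr_fun hm (hadd.mono inter_subset_left)]
  exact integral_add (r₁.integrableOn.mono_set (by rw [h₁]; exact inter_subset_left))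
    (r₂.integrableOn.mono_set (by rw [h₂]; exact inter_subset_left))

/-- The additivity-only sub-calculus lies in the kernel of every localised evaluation. [folklore] -/
theorem addOnlyRelations_le_ker_evalOn {A : (n : ℕ) → Set (Fin n → ℝ)}
    (hA : ∀ n, MeasurableSet (A n)) : addOnlyRelations ≤ (evalOn A).ker := by
  refine (AddSubgroup.closure_le _).mpr ?_
  rintro c (hc | hc)
  · exact evalOn_eq_zero_of_mem_domainAddRel hA hc
  · exact evalOn_eq_zero_of_mem_integrandAddRel hA hc

/-- The test family: the corner `{x | ∀ i, xᵢ < ½}` in every dimension. [folklore] -/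
def corner (n : ℕ) : Set (Fin n → ℝ) := {x | ∀ i, x i < 2⁻¹}

/-- Auxiliary: `measurableSet_corner`. [folklore] -/
theorem measurableSet_corner (n : ℕ) : MeasurableSet (corner n) := by
  have : corner n = Set.pi univ fun _ => Iio (2⁻¹ : ℝ) := by ext x; simp [corner]
  rw [this]
  exact MeasurableSet.univ_pi fun _ => measurableSet_Iio

/-- Auxiliary: `ubox_inter_corner`. [folklore] -/
theorem ubox_inter_corner : ubox ∩ corner 3 = Set.pi univ fun _ => Ioo (0:ℝ) 2⁻¹ := by
  ext x
  simp only [ubox, corner, mem_inter_iff, mem_setOf_eq, mem_Ioo, mem_univ_pi]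
  constructor
  · rintro ⟨h1, h2⟩ i
    exact ⟨(h1 i).1, h2 i⟩
  · intro h
    exact ⟨fun i => ⟨(h i).1, (h i).2.trans (by norm_num)⟩, fun i => (h i).2⟩

/-- Mass of `[box, 1]` in the corner: `1/8`. [folklore] -/
theorem evalOn_corner_one :
    evalOn corner (KZ.of (polyRep (Polynomial.C 1))) = 1 / 8 := by
  rw [evalOn_of, polyRep_domain, ubox_inter_corner]
  have h := setIntegral_pi_prod (fun _ => Ioo (0:ℝ) 2⁻¹) (fun _ _ => (1 : ℝ))
  simp only [Finset.prod_const_one] at h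
  simp only [polyRep_integrand, map_one]
  rw [h]
  simp
  norm_num

/-- Mass of `[box, 8t]` in the corner: `1/64`. [folklore] -/
theorem evalOn_corner_eightT :
    evalOn corner (KZ.of (polyRep (Polynomial.C 8 * Polynomial.X ^ 1))) = 1 / 64 := by
  rw [evalOn_of, polyRep_domain, ubox_inter_corner]
  have hint : ∫ t in Ioo (0:ℝ) 2⁻¹, t ^ 1 = 1 / 8 := by
    rw [← integral_Ioc_eq_integral_Ioo, ← intervalIntegral.integral_of_le (by norm_num), integral_pow]
    norm_num
  have h := setIntegral_pi_prod (fun _ => Ioo (0:ℝ) 2⁻¹) (fun _ t => t ^ 1)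
  simp only [Finset.prod_const, Finset.card_univ, Fintype.card_fin, hint] at h
  have hfun : (polyRep (Polynomial.C 8 * Polynomial.X ^ 1)).integrand =
      fun x => (8 : ℝ) * ∏ i, (x i) ^ 1 := by
    funext x
    simp [Fin.prod_univ_three]
  rw [hfun, MeasureTheory.integral_const_mul, h]
  norm_num

/-- `[box, 1] − [box, 8t]` is NOT in the additivity-only sub-calculus. [folklore] -/
theorem one_sub_eightT_not_mem_addOnlyRelations :
    KZ.of (polyRep (Polynomial.C 1)) - KZ.of (polyRep (Polynomial.C 8 * Polynomial.X ^ 1)) ∉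
      addOnlyRelations := by
  intro hmem
  have h0 := addOnlyRelations_le_ker_evalOn measurableSet_corner hmem
  rw [AddMonoidHom.mem_ker, map_sub, evalOn_corner_one, evalOn_corner_eightT] at h0
  norm_num at h0

/-- **Rule (1) is not enough.** There is a pair in the sector with equal values whose difference
lies outside `closure (domainAddRel ∪ integrandAddRel)`: any proof of `AperySectorThreeTwo` must
use a change of variables (rule 2) or a Newton–Leibniz move (rule 3). [folklore] -/
theorem aperySectorThreeTwo_needs_rule_two_or_three :
    ∃ (r r' : KZ.IntegralRep 3) (P P' : Polynomial ℚ), r.domain = ubox ∧ r'.domain = ubox ∧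
      EqOn r.integrand (fun x => Polynomial.aeval (x 0 * x 1 * x 2) P / (1 - (x 0 * x 1 * x 2) ^ 2)) r.domain ∧
      EqOn r'.integrand (fun x => Polynomial.aeval (x 0 * x 1 * x 2) P' / (1 - (x 0 * x 1 * x 2) ^ 2)) r'.domain ∧
      r.value = r'.value ∧ KZ.of r - KZ.of r' ∉ addOnlyRelations :=
  ⟨polyRep (Polynomial.C 1), polyRep (Polynomial.C 8 * Polynomial.X ^ 1), _, _, rfl, rfl,
    polyRep_eqOn _, polyRep_eqOn _, value_one_eq_value_eightT,
    one_sub_eightT_not_mem_addOnlyRelations⟩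

/-! ## §5 The polar pair `[box, 1/(1−t²)]`, `[box, 7t/(1−t²)]` -/

/-- On the corner sub-box `t = x₀x₁x₂ < 1/8`. [folklore] -/
theorem prod_lt_of_mem_corner {x : Fin 3 → ℝ} (hx : x ∈ Set.pi univ fun _ => Ioo (0:ℝ) 2⁻¹) :
    0 < x 0 * x 1 * x 2 ∧ x 0 * x 1 * x 2 < 8⁻¹ := by
  rw [mem_univ_pi] at hx
  have h0 := hx 0; have h1 := hx 1; have h2 := hx 2
  refine ⟨by have := h0.1; have := h1.1; have := h2.1; positivity, ?_⟩
  have := mul_lt_mul'' (mul_lt_mul'' h0.2 h1.2 h0.1.le h1.1.le) h2.2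
    (mul_nonneg h0.1.le h1.1.le) h2.1.le
  have h8 : (2⁻¹ : ℝ) * 2⁻¹ * 2⁻¹ = 8⁻¹ := by norm_num
  linarith [h8]

/-- The corner separates the polar pair: `∫_{(0,½)³} (1 − 7t)/(1 − t²) ≥ 1/64 > 0`, so
`[box, 1/(1−t²)] − [box, 7t/(1−t²)] ∉ closure (domainAddRel ∪ integrandAddRel)` — the
distribution relation `H₀ ∼ 7H₁` is not an additivity relation. [folklore] -/
theorem polar_not_mem_addOnlyRelations :
    KZ.of (sectorRep (Polynomial.C 1)) - KZ.of (sectorRep (Polynomial.C 7 * Polynomial.X ^ 1)) ∉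
      addOnlyRelations := by
  intro hmem
  have h0 := addOnlyRelations_le_ker_evalOn measurableSet_corner hmem
  rw [AddMonoidHom.mem_ker, map_sub, evalOn_of, evalOn_of, sectorRep_domain, sectorRep_domain,
    ubox_inter_corner] at h0
  set C : Set (Fin 3 → ℝ) := Set.pi univ fun _ => Ioo (0:ℝ) 2⁻¹ with hC
  have hCm : MeasurableSet C := MeasurableSet.univ_pi fun _ => measurableSet_Ioo
  have hCsub : C ⊆ ubox := by
    intro x hx
    rw [hC, mem_univ_pi] at hx
    exact fun i => ⟨(hx i).1, (hx i).2.trans (by norm_num)⟩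
  have hvol : volume C = ENNReal.ofReal 8⁻¹ := by
    rw [hC, volume_pi_pi]
    simp only [Real.volume_Ioo, Finset.prod_const, Finset.card_univ, Fintype.card_fin, sub_zero]
    rw [← ENNReal.ofReal_pow (by norm_num)]
    norm_num
  have hvolr : volume.real C = 8⁻¹ := by
    simp [Measure.real, hvol]
  have hi1 : IntegrableOn (sectorRep (Polynomial.C 1)).integrand C :=
    (sectorRep _).integrableOn.mono_set hCsub
  have hi7 : IntegrableOn (sectorRep (Polynomial.C 7 * Polynomial.X ^ 1)).integrand C :=
    (sectorRep _).integrableOn.mono_set hCsub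
  have hsub : (∫ x in C, (sectorRep (Polynomial.C 1)).integrand x) -
      (∫ x in C, (sectorRep (Polynomial.C 7 * Polynomial.X ^ 1)).integrand x) =
      ∫ x in C, ((sectorRep (Polynomial.C 1)).integrand x -
        (sectorRep (Polynomial.C 7 * Polynomial.X ^ 1)).integrand x) :=
    (integral_sub hi1 hi7).symm
  have hconst : IntegrableOn (fun _ : Fin 3 → ℝ => (8⁻¹ : ℝ)) C := by
    refine integrableOn_const ?_
    rw [hvol]; exact ENNReal.ofReal_ne_top
  have hle : ∫ _ in C, (8⁻¹ : ℝ) ≤ ∫ x in C, ((sectorRep (Polynomial.C 1)).integrand x -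
        (sectorRep (Polynomial.C 7 * Polynomial.X ^ 1)).integrand x) := by
    refine setIntegral_mono_on hconst (hi1.sub hi7) hCm fun x hx => ?_
    obtain ⟨ht0, ht8⟩ := prod_lt_of_mem_corner hx
    have hb : 0 < 1 - (x 0 * x 1 * x 2) ^ 2 := one_sub_sq_pos (hCsub hx)
    simp only [sectorRep_integrand, map_one, map_mul, Polynomial.aeval_C, map_pow,
      Polynomial.aeval_X, eq_ratCast]
    rw [← sub_div, le_div_iff₀ hb]
    push_cast
    nlinarith
  have hcv : ∫ _ in C, (8⁻¹ : ℝ) = 64⁻¹ := by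
    rw [setIntegral_const, hvolr]
    norm_num
  rw [hsub] at h0
  linarith

/-- **Rule (1) is not enough for the polar part either**: an equal-valued pair of GENUINE polar
members (`P = 1`, `P' = 7X`) outside the additivity-only sub-calculus. [folklore] -/
theorem aperySectorThreeTwo_polar_needs_rule_two_or_three :
    ∃ (r r' : KZ.IntegralRep 3) (P P' : Polynomial ℚ), r.domain = ubox ∧ r'.domain = ubox ∧
      EqOn r.integrand (fun x => Polynomial.aeval (x 0 * x 1 * x 2) P / (1 - (x 0 * x 1 * x 2) ^ 2)) r.domain ∧
      EqOn r'.integrand (fun x => Polynomial.aeval (x 0 * x 1 * x 2) P' / (1 - (x 0 * x 1 * x 2) ^ 2)) r'.domain ∧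
      r.value = r'.value ∧ KZ.of r - KZ.of r' ∉ addOnlyRelations :=
  ⟨sectorRep (Polynomial.C 1), sectorRep (Polynomial.C 7 * Polynomial.X ^ 1), _, _, rfl, rfl,
    fun _ _ => rfl, fun _ _ => rfl, polar_value_eq, polar_not_mem_addOnlyRelations⟩

/-! ## §6 Tightness of §4–§5: the ONE move that rule (1) lacks is available

The dilation `xᵢ ↦ xᵢᵐ` on the open box is a single `changeOfVariablesRel` instance in dimension
`3` (`dilation_mem_changeOfVariablesRel`; all analysis from the tree's
`BoxCoordinatePowerMap.lean`: derivative `diag(m xᵢ^{m−1})`, `|det| = m³∏xᵢ^{m−1}`, injectivity,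
`Φ '' box = box`). Consequences: the two pairs that §4–§5 put OUTSIDE the additivity-only
sub-calculus are connected by rule (2) (+ rule (1b) for the polar pair):
`poly_pair_mem_changeOfVariablesRel` (`[box, 8t] − [box, 1]`, `m = 2`, `g = 1`),
`polar_dilation_mem_changeOfVariablesRel` (`[box, 8t/(1−t²)] − [box, (1+t)/(1−t²)]`, `m = 2`,
`g = 1/(1−s)`), and `polar_equivalent : [box, 1/(1−t²)] ~ [box, 7t/(1−t²)]` — the distribution
relation `H₀ ∼ 7H₁` as an honest KZ-equivalence (one dilation, two integrand additivities).
They certify that the obstruction of §4–§5 is sharp: rule (1) + ONE instance of rule (2) connects each pair. -/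

/-- **The dilation move in dimension 3.** For `m ≥ 1` and reps `r`, `r'` on the open box with
`r.integrand x = r'.integrand (xᵢᵐ)ᵢ · m³ ∏ xᵢ^{m−1}` on the box, `[r] − [r']` is ONE
change-of-variables move (item DilationMove at `n = 3`). [folklore] -/
theorem dilation_mem_changeOfVariablesRel {m : ℕ} (hm : m ≠ 0) (r r' : KZ.IntegralRep 3)
    (hd : r.domain = ubox) (hd' : r'.domain = ubox)
    (h : ∀ x ∈ ubox, r.integrand x =
      r'.integrand (BoxIntegral.coordPow m x) * ((m : ℝ) ^ 3 * ∏ i, x i ^ (m - 1))) :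
    KZ.of r - KZ.of r' ∈ KZ.changeOfVariablesRel := by
  refine ⟨3, r, r', BoxIntegral.coordPow m, BoxIntegral.coordPowDeriv m, ?_, ?_, ?_, ?_, ?_, rfl⟩
  · rw [hd]
    exact (isSemialgebraicMapOn_aeval isSemialgebraic_ubox
      (fun i => (X i : MvPolynomial (Fin 3) ℚ) ^ m)).congr fun x _ => by
        funext j; simp
  · intro x _
    exact BoxIntegral.hasFDerivWithinAt_coordPow m _ x
  · rw [hd]
    exact BoxIntegral.injOn_coordPow_box hm
  · rw [hd, hd']
    exact (BoxIntegral.image_coordPow_box hm).symm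
  · intro x hx
    rw [hd] at hx
    rw [h x hx, BoxIntegral.abs_det_coordPowDeriv hm hx]

/-- The polynomial pair of §3–§4 is ONE dilation (`m = 2`, `g ≡ 1`):
`[box, 8t] − [box, 1] ∈ changeOfVariablesRel`. [folklore] -/
theorem poly_pair_mem_changeOfVariablesRel :
    KZ.of (polyRep (Polynomial.C 8 * Polynomial.X ^ 1)) - KZ.of (polyRep (Polynomial.C 1)) ∈
      KZ.changeOfVariablesRel := by
  refine dilation_mem_changeOfVariablesRel (m := 2) two_ne_zero _ _ rfl rfl fun x _ => ?_
  simp only [polyRep_integrand, map_mul, Polynomial.aeval_C, map_pow, Polynomial.aeval_X, map_one,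
    BoxIntegral.coordPow_apply, Fin.prod_univ_three, eq_ratCast]
  push_cast
  ring

/-- Hence the polynomial pair is KZ-equivalent (one move). [folklore] -/
theorem poly_pair_equivalent :
    KZ.Equivalent (polyRep (Polynomial.C 1)) (polyRep (Polynomial.C 8 * Polynomial.X ^ 1)) :=
  KZ.Equivalent.symm (KZ.changeOfVariablesRel_subset_relations poly_pair_mem_changeOfVariablesRel)

/-- The polar dilation (`m = 2`, `g = 1/(1 − s) = (1+s)/(1−s²)`):
`[box, 8t/(1−t²)] − [box, (1+t)/(1−t²)] ∈ changeOfVariablesRel` (`8H₁ ∼ H₀ + H₁`). [folklore] -/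
theorem polar_dilation_mem_changeOfVariablesRel :
    KZ.of (sectorRep (Polynomial.C 8 * Polynomial.X ^ 1)) - KZ.of (sectorRep (1 + Polynomial.X)) ∈
      KZ.changeOfVariablesRel := by
  refine dilation_mem_changeOfVariablesRel (m := 2) two_ne_zero _ _ rfl rfl fun x hx => ?_
  have ht := prod_mem_Ioo hx
  have hsq : (x 0 * x 1 * x 2) ^ 2 < 1 := by nlinarith [ht.1, ht.2]
  have hA : (1 : ℝ) - (x 0 * x 1 * x 2) ^ 2 ≠ 0 := by linarith
  have hB : (1 : ℝ) - (x 0 ^ 2 * x 1 ^ 2 * x 2 ^ 2) ^ 2 ≠ 0 := by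
    have : (x 0 ^ 2 * x 1 ^ 2 * x 2 ^ 2) ^ 2 = ((x 0 * x 1 * x 2) ^ 2) ^ 2 := by ring
    rw [this]
    have h0 : 0 ≤ (x 0 * x 1 * x 2) ^ 2 := sq_nonneg _
    have hlt : ((x 0 * x 1 * x 2) ^ 2) ^ 2 < 1 := by nlinarith
    linarith
  simp only [sectorRep_integrand, BoxIntegral.coordPow_apply, Fin.prod_univ_three, map_mul,
    Polynomial.aeval_C, map_pow, Polynomial.aeval_X, map_add, map_one, eq_ratCast]
  push_cast
  rw [eq_comm, div_mul_eq_mul_div, div_eq_div_iff hB hA]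
  ring

/-- Integrand additivity inside the sector: `[P₁ + P₂] − [P₁] − [P₂] ∈ integrandAddRel`. [folklore] -/
theorem sectorRep_add_mem_integrandAddRel (P₁ P₂ : Polynomial ℚ) :
    KZ.of (sectorRep (P₁ + P₂)) - KZ.of (sectorRep P₁) - KZ.of (sectorRep P₂) ∈
      KZ.integrandAddRel := by
  refine ⟨3, sectorRep (P₁ + P₂), sectorRep P₁, sectorRep P₂, rfl, rfl, fun x _ => ?_, rfl⟩
  simp only [sectorRep_integrand, Pi.add_apply, map_add, add_div]

/-- **The distribution relation as an honest KZ-equivalence**: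
`[box, 1/(1−t²)] ~ [box, 7t/(1−t²)]` by ONE dilation and TWO integrand additivities
(`[1] − [7t] = −([1+t]−[1]−[t]) − ([8t]−[1+t]) + ([8t]−[t]−[7t])`). [folklore] -/
theorem polar_equivalent :
    KZ.Equivalent (sectorRep (Polynomial.C 1)) (sectorRep (Polynomial.C 7 * Polynomial.X ^ 1)) := by
  have hA : KZ.of (sectorRep (Polynomial.C 1 + Polynomial.X ^ 1)) - KZ.of (sectorRep (Polynomial.C 1)) -
      KZ.of (sectorRep (Polynomial.X ^ 1)) ∈ KZ.relations :=
    KZ.integrandAddRel_subset_relations (sectorRep_add_mem_integrandAddRel _ _)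
  have hB : KZ.of (sectorRep (Polynomial.C 8 * Polynomial.X ^ 1)) -
      KZ.of (sectorRep (Polynomial.C 1 + Polynomial.X ^ 1)) ∈ KZ.relations := by
    have h := KZ.changeOfVariablesRel_subset_relations polar_dilation_mem_changeOfVariablesRel
    have he : sectorRep (1 + Polynomial.X) = sectorRep (Polynomial.C 1 + Polynomial.X ^ 1) := by
      simp
    rwa [he] at h
  have hC : KZ.of (sectorRep (Polynomial.X ^ 1 + Polynomial.C 7 * Polynomial.X ^ 1)) -
      KZ.of (sectorRep (Polynomial.X ^ 1)) - KZ.of (sectorRep (Polynomial.C 7 * Polynomial.X ^ 1)) ∈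
      KZ.relations :=
    KZ.integrandAddRel_subset_relations (sectorRep_add_mem_integrandAddRel _ _)
  have he8 : sectorRep (Polynomial.X ^ 1 + Polynomial.C 7 * Polynomial.X ^ 1) =
      sectorRep (Polynomial.C 8 * Polynomial.X ^ 1) := by
    congr 1
    have h7 : (Polynomial.C (7 : ℚ)) = 7 := rfl
    have h8 : (Polynomial.C (8 : ℚ)) = 8 := rfl
    rw [h7, h8]; ring
  rw [he8] at hC
  have : KZ.of (sectorRep (Polynomial.C 1)) - KZ.of (sectorRep (Polynomial.C 7 * Polynomial.X ^ 1)) =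
      -(KZ.of (sectorRep (Polynomial.C 1 + Polynomial.X ^ 1)) - KZ.of (sectorRep (Polynomial.C 1)) -
          KZ.of (sectorRep (Polynomial.X ^ 1))) -
        (KZ.of (sectorRep (Polynomial.C 8 * Polynomial.X ^ 1)) -
          KZ.of (sectorRep (Polynomial.C 1 + Polynomial.X ^ 1))) +
        (KZ.of (sectorRep (Polynomial.C 8 * Polynomial.X ^ 1)) - KZ.of (sectorRep (Polynomial.X ^ 1)) -
          KZ.of (sectorRep (Polynomial.C 7 * Polynomial.X ^ 1))) := by
    abel
  show KZ.of (sectorRep (Polynomial.C 1)) - KZ.of (sectorRep (Polynomial.C 7 * Polynomial.X ^ 1)) ∈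
    KZ.relations
  rw [this]
  exact KZ.relations.add_mem (KZ.relations.sub_mem (KZ.relations.neg_mem hA) hB) hC

end Summit.KontsevichZagierPeriods.Theorems.AperySectorThreeTwo.Negative

end
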